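import Summits.QuantumFields.YangMills.Theorems.SqueezedSkewnessSpectralIdentificationLStubOSData
import HarnessLib

/-!
# Route `SqueezedSkewness`, support `SpectralIdentification` (stmt-QuantumFields-22662) — BY WEAKENING from the crux
# `SpectralIdentificationL` (stmt-QuantumFields-22796)

`spectralIdentification_proof : Theses.SqueezedSkewness.SpectralIdentification` BY NAME.  The LINE-1 Källén–Lehmann content of the
split of `VacuumDomination` (stmt-QuantumFields-28192, ideator ym-idea-6 g8 LINE «KL split») follows from the refined crux
`SpectralIdentificationL` (proved by this seat, `TorusKL.spectralIdentificationL_proof`): its admissible class `closedBall (0, R)`,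
`R ≤ sL`, is contained in the compact-height / open-cube class (`|y_i| ≤ ‖y‖ ≤ R ≤ sL < s(L + ½)`, height `H := R`), the momenta are
the real reciprocal-lattice vectors `p_n = 2π q_n / (s(2L+1))`, and the limit of the reflection form is unique (`tendsto_nhds_unique`).
Seat `ym-line-fcl-p3` g17 (cell ym-idea-1; free hands).  HONEST FRAMING: a finite-volume / infinite-time transfer-matrix identity;
nothing about NT, a continuum limit or the mass gap is proved.
References: M. Lüscher, Comm. Math. Phys. 54 (1977) 283 [cite: Luscher1977]; I. Montvay, G. Münster, *Quantum Fields on a Lattice*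
(1994) §3.2.6 [cite: MontvayMunster1994, §3.2.6].
-/

set_option autoImplicit false

noncomputable section

open Filter Topology

namespace Summit.QuantumFields.YangMills.Theorems.TorusKL

/-- ★★ **`SqueezedSkewness.SpectralIdentification` (stmt-QuantumFields-22662) HOLDS**, by weakening `SpectralIdentificationL`.
[cite: Luscher1977] [cite: MontvayMunster1994, §3.2.6] -/
theorem spectralIdentification_proof : Summit.QuantumFields.YangMills.Theses.SqueezedSkewness.SpectralIdentification := by
  intro G _ _ _ _ r St Cfg cc posE P A w E Cov refl B Qrp amp β L s hβ hL hs
  obtain ⟨W, μ, q, hW, hμ, hspec⟩ := spectralIdentificationL_proof G r β L s hβ hL hs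
  refine ⟨W, μ, fun n i => 2 * Real.pi * (q n i : ℝ) / (s * (2 * L + 1)), hW, hμ, fun R f hf0 hfR hRL Q hQ => ?_⟩
  have hf1 : tsupport (f : EuclideanSpace ℝ (Fin 4) → ℝ) ⊆ {y : EuclideanSpace ℝ (Fin 4) | 0 < y 0 ∧ y 0 ≤ R} := by
    intro y hy
    refine ⟨hf0 hy, ?_⟩
    have h1 : ‖y‖ ≤ R := by simpa [Metric.mem_closedBall, dist_zero_right] using hfR hy
    exact ((le_abs_self _).trans ((Real.norm_eq_abs _) ▸ PiLp.norm_apply_le y 0)).trans h1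
  have hf2 : tsupport (f : EuclideanSpace ℝ (Fin 4) → ℝ) ⊆ {y : EuclideanSpace ℝ (Fin 4) | ∀ i : Fin 3, |y i.succ| < s * (L + 1 / 2)} := by
    intro y hy i
    have h1 : ‖y‖ ≤ R := by simpa [Metric.mem_closedBall, dist_zero_right] using hfR hy
    have h2 : |y i.succ| ≤ R := ((Real.norm_eq_abs _) ▸ PiLp.norm_apply_le y i.succ).trans h1
    have h3 : (R : ℝ) < s * (L + 1 / 2) := by nlinarith
    exact lt_of_le_of_lt h2 h3
  obtain ⟨Q', hQ', hsum⟩ := hspec R f hf1 hf2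
  have hQQ : Q' = Q := tendsto_nhds_unique hQ' hQ
  rw [← hQQ]
  exact hsum

end Summit.QuantumFields.YangMills.Theorems.TorusKL

end
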